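import Summits.BirchSwinnertonDyer.Rank1Residual.ManinAdditive.TwoNotDvdManinOfTwistEtaTwo
import Summits.BirchSwinnertonDyer.Rank1Residual.ManinAdditive.TwoNotDvdManinOfTwistOfSemistableAtTwo
import Summits.BirchSwinnertonDyer.Rank1Residual.ManinConstantOne
import Literature.NumberTheory.EllipticCurves.ModularityVersionApProofs
import HarnessLib

/-!
# Placement edges of candidates E-an-1 / E-an-2 (cell bsd-f2-manin) — PROVED

* `twoNotDvdManinOfTwistEtaTwo_of_maninConstantOne`, `…OfSemistableAtTwo_of_maninConstantOne` :
  Manin's conjecture ⟹ each law (`|c₀| = 1` on lattice-optimal data of minimal curves);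
* `twoNotDvdManinOfTwistEtaTwo_of_union` : E-an-2 ⟹ E-an-1 (restriction: good at `2` ⟹ `4 ∤ N(W′)`);
* `twoNotDvdManinOfTwistOfSemistableAtTwo_of_etaTwo` : E-an-1 ⟹ E-an-2, by the tree THEOREM
  `not_dvd_maninConstant_of_isTwistOfSemistableAtTwo_etaOne_gamma0` on the `η = 1` part and E-an-1 on
  its complement (`d = ±2`, `2 ∤ N(W′)` i.e. good at `2`, `a₂` even) — so E-an-2 ⟺ E-an-1 over the
  tree: the beyond-print content of the union law is exactly the `η = 2` law.
Nothing else is claimed; no fact is introduced.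
-/

noncomputable section

open scoped MatrixGroups ModularForm

open CongruenceSubgroup WeierstrassCurve
  Literature.NumberTheory.EllipticCurves Literature.NumberTheory.EllipticCurves.ModularForms
  Summit.BirchSwinnertonDyer.Rank1Residual.ManinConstant

namespace Summit.BirchSwinnertonDyer.Rank1Residual.ManinAdditive

/-- **Manin ⟹ E-an-1.** -/
theorem twoNotDvdManinOfTwistEtaTwo_of_maninConstantOne (hMC : ManinConstantOne) :
    TwoNotDvdManinOfTwistEtaTwo := by
  intro _ _ _ _ W _ W' _ _ d _ _ _ _ _ _ _ W₀ _ _ N₀ _ D₀ _ h₀ hdvd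
  have h1 : |D₀.maninConstant| = 1 := hMC W₀ D₀ h₀
  have h2 : (2 : ℤ) ∣ 1 := h1 ▸ (dvd_abs _ _).mpr hdvd
  omega

/-- **Manin ⟹ E-an-2.** -/
theorem twoNotDvdManinOfTwistOfSemistableAtTwo_of_maninConstantOne (hMC : ManinConstantOne) :
    TwoNotDvdManinOfTwistOfSemistableAtTwo := by
  intro _ _ _ _ W _ W' _ _ d _ _ _ _ _ _ W₀ _ _ N₀ _ D₀ _ h₀ hdvd
  have h1 : |D₀.maninConstant| = 1 := hMC W₀ D₀ h₀
  have h2 : (2 : ℤ) ∣ 1 := h1 ▸ (dvd_abs _ _).mpr hdvd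
  omega

/-- **E-an-2 ⟹ E-an-1** (the `η = 2` configuration is a sub-case of the union law: `W′` good at `2`
gives `2 ∤ N(W′)`, hence `4 ∤ N(W′)`, by `dvd_conductorNorm_iff_not_hasGoodReductionAtPrime`). -/
theorem twoNotDvdManinOfTwistEtaTwo_of_union (h : TwoNotDvdManinOfTwistOfSemistableAtTwo) :
    TwoNotDvdManinOfTwistEtaTwo := by
  intro hM hAU hC2 hnf W _ W' _ _ d hd htw hN'N hmN hgood _ hadd W₀ _ _ N₀ _ D₀ hiso h₀
  haveI : Fact (Nat.Prime 2) := ⟨Nat.prime_two⟩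
  have h2N' : ¬ 2 ∣ W'.conductorNorm ℤ := fun h2 ↦
    ((dvd_conductorNorm_iff_not_hasGoodReductionAtPrime W' 2).mp h2) hgood
  have h4N' : ¬ 2 ^ 2 ∣ W'.conductorNorm ℤ := fun h4 ↦ h2N' (dvd_trans ⟨2, by norm_num⟩ h4)
  exact h hM hAU hC2 hnf (Or.inr hd) htw hN'N hmN h4N' hadd W₀ D₀ hiso h₀

/-- **E-an-1 ⟹ E-an-2** over the tree: split on Stevens' `η`. If `d = -1`, or `2 ∣ N(W′)`, or
`a₂(W′)` is odd (`η = 1`), the tree theorem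
`not_dvd_maninConstant_of_isTwistOfSemistableAtTwo_etaOne_gamma0` applies; otherwise `d = ±2`,
`W′` is good at `2` (`2 ∤ N(W′)`) with `a₂` even — the `η = 2` law. -/
theorem twoNotDvdManinOfTwistOfSemistableAtTwo_of_etaTwo (h : TwoNotDvdManinOfTwistEtaTwo) :
    TwoNotDvdManinOfTwistOfSemistableAtTwo := by
  intro hM hAU hC2 hnf W _ W' _ _ d hd htw hN'N hmN h4N' hadd W₀ _ _ N₀ _ D₀ hiso h₀
  haveI : Fact (Nat.Prime 2) := ⟨Nat.prime_two⟩
  by_cases hη : d = -1 ∨ 2 ∣ W'.conductorNorm ℤ ∨ Odd (W'.LFunction 2)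
  · exact not_dvd_maninConstant_of_isTwistOfSemistableAtTwo_etaOne_gamma0 hM hAU hC2 hnf hd htw
      hN'N hmN h4N' hη hadd W₀ D₀ hiso h₀
  · push Not at hη
    obtain ⟨hd1, h2N', heven⟩ := hη
    have hd' : d = 2 ∨ d = -2 := by
      rcases hd with h1 | h2 | h3
      · exact absurd h1 hd1
      · exact Or.inl h2
      · exact Or.inr h3
    have hgood : W'.HasGoodReductionAtPrime 2 := by
      by_contra hng
      exact h2N' ((dvd_conductorNorm_iff_not_hasGoodReductionAtPrime W' 2).mpr hng)
    have hss : Even (W'.LFunction 2) := Int.not_odd_iff_even.mp heven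
    exact h hM hAU hC2 hnf hd' htw hN'N hmN hgood hss hadd W₀ D₀ hiso h₀

end Summit.BirchSwinnertonDyer.Rank1Residual.ManinAdditive

end
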